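import Literature.IUT.HodgeTheaters.FreeProfiniteCompletionIso
import HarnessLib

/-!
# [IUTchI] Prop. 2.4 (i), input "`Δ^tp_X` is dense in `Δ̂_X`" REDUCED to the exactness of the two
# fundamental sequences as TOPOLOGICAL groups — PROOFS

Mochizuki, *Inter-universal Teichmüller theory I*, kurims manuscript (May 2020), §2, p. 47 l. 11–13: "`Δ̂_X`
may be identified with the pro-`Σ̂` completion of `Δ^tp_X`", used in the proof of Proposition 2.4 (i),
p. 50 l. 34–36 [cite: Mochizuki2012, Prop 2.4(i) p.50] (D-0012 claim key; nothing of the series is asserted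
here).  PROOF-ONLY companion (seat abc-iut-w4-d055) of abc-iut-w5-d119's sub-DAG statements file
`TemperedCoveringsProp24Sub.lean` (plan/L5/SUBDAG-IUTchI-Prop24.md, sub-row P24i.r3), where the input is the
named sub-node `StableCurveTemperedData.DeltaHatDense` ("`Δ̂_X ⊆` closure of `ι(Δ^tp_X)`").

Here `DeltaHatDense` is DERIVED (`StableCurveTemperedData.deltaHatDense_of_denseRange`) from three
structural facts about the genuine exact sequences `1 → Δ^tp_X → Π^tp_X → G_k → 1` and
`1 → Δ̂_X → Π̂_X → G_k → 1` ([IUTchI] p. 47; [SemiAnbd] Ex. 3.10, Prop. 3.6 (iii)):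
(a) `ι : Π^tp_X → Π̂_X` has DENSE image ("`Π̂_X` is the profinite completion of `Π^tp_X`" — the L3
predicate `IsProfiniteCompletion` carries this); (b) `Π^tp_X ↠ G_k` is an OPEN map (exactness as
topological groups); (c) `Π̂_X ↠ G_k` is continuous.  Proof: for `δ ∈ Δ̂_X` and an open subgroup
`U ⊆ Π̂_X`, density gives `t ∈ Π^tp_X` with `ι(t) ∈ δU`; then `pr(t) ∈ pr̂(U) ⊆ cl pr(ι⁻¹U) = pr(ι⁻¹U)` (open
subgroups of `G_k` are closed), so `pr(t) = pr(v)` with `ι(v) ∈ U`, and `d := t v⁻¹ ∈ Δ^tp_X` has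
`ι(d) ∈ δU`.  Also `DeltaHatClosed` from (c) (`deltaHatClosed_of_continuous`), and the capstone
`prop24i_of_sub_structural`: Prop. 2.4 (i) AS TYPED from the tower bookkeeping, (a)(b)(c), the L3 datum
"`Δ̂_X` free profinite of finite rank" (`IsFreeProfiniteOn`, via `prop24i_of_sub_of_isFreeProfiniteOn`,
p418966), Prop. 2.1 at every level, the `p ∉ Σ` abelianization comparison, and abc-iut-L5-t11's tempered
inverse-limit inputs `hmono`/`hlim`.  No new definition; nothing here bears on [IUTchIII] Cor. 3.12.
-/

namespace Literature.IUT.HodgeTheaters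

open _root_.Topology

universe u

namespace StableCurveTemperedData

variable (D : StableCurveTemperedData.{u})

/-- **`DeltaHatDense` from density of `Π^tp_X` in `Π̂_X` and topological exactness** (p. 47 l. 11–13 with
[SemiAnbd] Ex. 3.10): if `ι(Π^tp_X)` is dense in the profinite `Π̂_X`, `Π^tp_X ↠ G_k` is an open map and
`Π̂_X ↠ G_k` is continuous, then `Δ̂_X` lies in the closure of `ι(Δ^tp_X)`.
[cite: Mochizuki2012, Prop 2.4(i) p.50] -/
theorem deltaHatDense_of_denseRange [TotallyDisconnectedSpace D.PiHat] [IsTopologicalGroup D.Gk]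
    (hd : DenseRange D.ιX) (hopen : IsOpenMap D.prTp) (hc : Continuous D.prHat) : D.DeltaHatDense := by
  intro δ hδ
  rw [mem_closure_iff]
  intro O hO hδO
  -- an open (normal) subgroup `U` of `Π̂_X` with `δ·U ⊆ O`
  have hO' : IsOpen ((fun y : D.PiHat => δ * y) ⁻¹' O) := hO.preimage (continuous_const_mul δ)
  obtain ⟨U, hU⟩ := ProfiniteGrp.exist_openNormalSubgroup_sub_open_nhds_of_one hO' (by simpa using hδO)
  -- density: some `ι(t)` lies in `δ·U`
  have hδU : IsOpen ((fun y : D.PiHat => δ⁻¹ * y) ⁻¹' (U : Set D.PiHat)) :=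
    U.isOpen'.preimage (continuous_const_mul δ⁻¹)
  obtain ⟨t, ht⟩ := hd.exists_mem_open hδU ⟨δ, by simp⟩
  have ht' : δ⁻¹ * D.ιX t ∈ U := ht
  -- `V := ι⁻¹(U)`, an open subgroup of `Π^tp_X`; its image in `G_k` is open, hence closed
  let V : Subgroup D.PiTp := U.toSubgroup.comap D.ιX
  have hVo : IsOpen (V : Set D.PiTp) := U.isOpen'.preimage D.ιX_continuous
  have hWo : IsOpen ((V.map D.prTp : Subgroup D.Gk) : Set D.Gk) := by
    rw [Subgroup.coe_map]; exact hopen _ hVo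
  have hWc : IsClosed ((V.map D.prTp : Subgroup D.Gk) : Set D.Gk) := Subgroup.isClosed_of_isOpen _ hWo
  -- `pr̂(U) ⊆ cl pr(V)`: `U ∩ ι(Π^tp_X)` is dense in the open set `U`
  have hsub : D.prHat '' (U : Set D.PiHat) ⊆ ((V.map D.prTp : Subgroup D.Gk) : Set D.Gk) := by
    rw [← hWc.closure_eq]
    have h1 : (U : Set D.PiHat) ⊆ closure ((U : Set D.PiHat) ∩ Set.range D.ιX) :=
      hd.open_subset_closure_inter U.isOpen'
    have h2 : D.prHat '' ((U : Set D.PiHat) ∩ Set.range D.ιX) ⊆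
        ((V.map D.prTp : Subgroup D.Gk) : Set D.Gk) := by
      rintro _ ⟨y, ⟨hyU, ⟨v, rfl⟩⟩, rfl⟩
      refine ⟨v, hyU, ?_⟩
      rw [← MonoidHom.comp_apply, D.prHat_comp]
    calc D.prHat '' (U : Set D.PiHat)
        ⊆ D.prHat '' closure ((U : Set D.PiHat) ∩ Set.range D.ιX) := Set.image_mono h1
      _ ⊆ closure (D.prHat '' ((U : Set D.PiHat) ∩ Set.range D.ιX)) :=
          image_closure_subset_closure_image hc
      _ ⊆ closure ((V.map D.prTp : Subgroup D.Gk) : Set D.Gk) := closure_mono h2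
  -- hence `pr(t) = pr(v)` for some `v ∈ V`
  have hprt : D.prTp t ∈ V.map D.prTp := by
    have e : D.prTp t = D.prHat (δ⁻¹ * D.ιX t) := by
      rw [map_mul, map_inv, (MonoidHom.mem_ker).mp hδ, inv_one, one_mul, ← MonoidHom.comp_apply,
        D.prHat_comp]
    rw [e]
    exact hsub ⟨_, ht', rfl⟩
  obtain ⟨v, hvV, hv⟩ := hprt
  -- `d := t·v⁻¹ ∈ Δ^tp_X` with `ι(d) ∈ δ·U ⊆ O`
  have hd' : t * v⁻¹ ∈ D.DeltaTp := by
    rw [MonoidHom.mem_ker, map_mul, map_inv, ← hv, mul_inv_cancel]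
  refine ⟨D.ιX (t * v⁻¹), ?_, ⟨⟨t * v⁻¹, hd'⟩, rfl⟩⟩
  have hmem : δ⁻¹ * D.ιX (t * v⁻¹) ∈ U := by
    rw [map_mul, map_inv, ← mul_assoc]
    exact U.toSubgroup.mul_mem ht' (U.toSubgroup.inv_mem hvV)
  have := hU hmem
  simpa [Set.mem_preimage, mul_inv_cancel_left] using this

/-- **`DeltaHatClosed` from the continuity of `Π̂_X ↠ G_k`** (`Δ̂_X` is the kernel, `G_k` is T₁).
[cite: Mochizuki2012, §2 p.47] -/
theorem deltaHatClosed_of_continuous [T1Space D.Gk] (hc : Continuous D.prHat) : D.DeltaHatClosed := by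
  have e : ((D.DeltaHat : Subgroup D.PiHat) : Set D.PiHat) = D.prHat ⁻¹' {1} := by
    ext x; exact MonoidHom.mem_ker
  change IsClosed ((D.DeltaHat : Subgroup D.PiHat) : Set D.PiHat)
  rw [e]
  exact isClosed_singleton.preimage hc

variable {D} in
/-- **[IUTchI] Prop. 2.4 (i) from STRUCTURAL inputs**: the tower bookkeeping of the sub-DAG; density of
`Π^tp_X` in the profinite `Π̂_X`, openness of `Π^tp_X ↠ G_k`, continuity of `Π̂_X ↠ G_k` (p. 47); `Δ̂_X` free
profinite of finite rank (`IsFreeProfiniteOn`, [EtTh] §1 / L3); Prop. 2.1 at every level; the `p ∉ Σ`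
abelianization comparison; the tempered inverse-limit inputs `hmono`, `hlim` (abc-iut-L5-t11).  The four
ad-hoc sub-nodes `DeltaHatClosed`, `DeltaHatDense`, `StronglyTorsionFreeSigma`, `DetectsTempered` of
`prop24i_of_sub` are all DERIVED. [cite: Mochizuki2012, Prop 2.4(i) p.50] -/
theorem prop24i_of_sub_structural [T2Space D.PiHat] [TotallyDisconnectedSpace D.PiHat]
    [IsTopologicalGroup D.Gk] [T1Space D.Gk] (T : D.Prop24Tower)
    (hdense : DenseRange D.ιX) (hopen : IsOpenMap D.prTp) (hc : Continuous D.prHat)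
    {ι : Type u} [Finite ι] {x : ι → D.DeltaHat}
    (hx : Literature.AnabelianGeometry.SemiGraphs.IsFreeProfiniteOn D.DeltaHat x)
    (hΔ : T.LevelsInDelta) (hn : T.LevelsNormal) (ho : T.LevelsOpen) (hcof : T.LevelsCofinal)
    (h21 : T.Prop21Levels) (hspec : T.SpecializationAb)
    (hmono : ∀ i j, T.Jhat j ≤ T.Jhat i →
      ((T.πhat j).ker.map (T.Jhat j).subtype) ≤ ((T.πhat i).ker.map (T.Jhat i).subtype))
    (hlim : ∀ W : Subgroup D.PiHat, (∃ i, T.Jhat i ≤ W) → ∀ t : T.I → D.PiTp,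
      (∀ i j, T.Jhat i ≤ W → T.Jhat j ≤ T.Jhat i →
        D.ιX ((t i)⁻¹ * t j) ∈ ((T.πhat i).ker.map (T.Jhat i).subtype)) →
      ∃ s : D.PiTp, ∀ i, T.Jhat i ≤ W → D.ιX (s⁻¹ * t i) ∈ ((T.πhat i).ker.map (T.Jhat i).subtype)) :
    D.Prop24i :=
  prop24i_of_sub_of_isFreeProfiniteOn T (D.deltaHatClosed_of_continuous hc)
    (D.deltaHatDense_of_denseRange hdense hopen hc) hx hΔ hn ho hcof h21 hspec hmono hlim

end StableCurveTemperedData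

end Literature.IUT.HodgeTheaters
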